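import Mathlib
import HarnessLib
import Summits.NavierStokesRegularity.NavierStokesRegularity.Theorems.FrequencyGrowthExponent.Negative.Reductions
import Summits.NavierStokesRegularity.NavierStokesRegularity.Theorems.PoloidalWindowDoorPoloidalWindowRigidityLoopIslandReduction

/-!
# Crux `FrequencyGrowthExponent` (stmt-NavierStokesRegularity-27893), negative side:
# the island door is the loop door — `W = HasClassLoop ↔ ∃ class poloidal profile with a planar island bracket`

Negative-side (cdisprove, D-0016) bookkeeping for the wall `LoopPeriodRatchet.FrequencyGrowthExponent`; nothing here
closes or changes any item (`--supports`).  The tree now holds the sorry-free SCALAR form of the wall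
(`…LoopIslandReduction.frequencyGrowthExponent_iff_noIslands`, K2-p2 g12 p676353): the wall holds iff every class
e₃-poloidal profile carrying an ISLAND BRACKET of `σ v₂` on a horizontal plane at some time (a non-empty compact set `K`
where `σ v₂ = M`, inside an open `O` on whose trace `σ v₂ ≤ M` with equality only on `K`) vanishes identically.
For the negation-first reading this gives a second search object; this file shows it is the SAME object as
`W = HasClassLoop` of `Negative/Reductions`, with no separate non-triviality clause:

* `slice_ne_zero_of_island` — an island bracket forces `v(s₀,·) ≢ 0` (if the slice vanished, `M = 0` and the
  horizontal line through a point of `K` would meet `K` in a non-empty clopen subset of `ℝ`, i.e. lie inside the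
  compact `K`);
* `hasClassLoop_iff_hasIsland` — `HasClassLoop ↔ ∃` class e₃-poloidal profile, `∃ s₀ < 0`, `∃` island bracket at `s₀`.

So a candidate `W` may be certified by exhibiting a planar strict local extremal plateau of `±v₂` on ONE slice instead of
integrating a closed vortex line.  HONEST FRAMING: corollary of landed theorems; nothing here bears on
`PoloidalWindowDoor.Target` or on Navier–Stokes regularity; item 27893 stays OPEN.
-/

noncomputable section

-- the summit and its single sub-problem share the name (CONVENTIONS §1), as in every Theorems file
set_option linter.dupNamespace false

namespace Summit.NavierStokesRegularity.NavierStokesRegularity.Theorems.FrequencyGrowthExponent.Negative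

open Set Function Filter Topology
open scoped RealInnerProductSpace InnerProductSpace
open Literature.Analysis Literature.Analysis.FluidPDE Literature.Analysis.UnboundedOperators
open Summit.NavierStokesRegularity.NavierStokesRegularity.Theorems

variable {v : ℝ → EuclideanSpace ℝ (Fin 3) → EuclideanSpace ℝ (Fin 3)}

/-- **An island bracket lives on a non-zero slice.** If `K ≠ ∅` is compact, contained in the plane `{y₂ = z₁}` and in
an open set `O`, `σ v₂(s₀,·) = M` on `K`, `≤ M` on `O ∩ {y₂ = z₁}` with equality there only on `K`, then `v(s₀,·)`
does not vanish identically. -/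
theorem slice_ne_zero_of_island {s₀ z₁ σ M : ℝ} {K O : Set (EuclideanSpace ℝ (Fin 3))}
    (hbr : (σ = 1 ∨ σ = -1) ∧ IsCompact K ∧ K.Nonempty ∧ (∀ y ∈ K, y 2 = z₁ ∧ σ * v s₀ y 2 = M) ∧
      IsOpen O ∧ K ⊆ O ∧ (∀ y ∈ O, y 2 = z₁ → σ * v s₀ y 2 ≤ M) ∧
      (∀ y ∈ O, y 2 = z₁ → σ * v s₀ y 2 = M → y ∈ K)) :
    ∃ y, v s₀ y ≠ 0 := by
  by_contra hzero
  push Not at hzero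
  obtain ⟨-, hKc, ⟨y₀, hy₀⟩, hKplane, hO, hKO, -, hback⟩ := hbr
  have hM : M = 0 := by
    have h := (hKplane y₀ hy₀).2
    rw [hzero y₀] at h
    simpa using h.symm
  -- the horizontal line through `y₀`
  set e : EuclideanSpace ℝ (Fin 3) := EuclideanSpace.single 0 1 with he
  set f : ℝ → EuclideanSpace ℝ (Fin 3) := fun r => y₀ + r • e with hf
  have hfc : Continuous f := by fun_prop
  have hf2 : ∀ r, f r 2 = z₁ := fun r => by
    simp [hf, he, (hKplane y₀ hy₀).1]
  have hA : IsClopen (f ⁻¹' K) := by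
    refine ⟨hKc.isClosed.preimage hfc, ?_⟩
    rw [isOpen_iff_mem_nhds]
    intro r hr
    filter_upwards [(hO.preimage hfc).mem_nhds (hKO hr)] with r' hr'
    exact hback (f r') hr' (hf2 r') (by simp [hzero, hM])
  have hAuniv : f ⁻¹' K = univ := hA.eq_univ ⟨0, by simpa [hf] using hy₀⟩
  obtain ⟨R, hR⟩ := hKc.isBounded.exists_norm_le
  have hmem : f (R + ‖y₀‖ + 1) ∈ K := by
    have h : R + ‖y₀‖ + 1 ∈ f ⁻¹' K := by rw [hAuniv]; trivial
    exact h
  have hle := hR _ hmem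
  have hnorm : ‖(R + ‖y₀‖ + 1) • e‖ = |R + ‖y₀‖ + 1| := by
    simp [he, norm_smul]
  have hge : |R + ‖y₀‖ + 1| - ‖y₀‖ ≤ ‖f (R + ‖y₀‖ + 1)‖ := by
    have h := norm_sub_le_norm_add ((R + ‖y₀‖ + 1) • e) y₀
    rw [hnorm, add_comm ((R + ‖y₀‖ + 1) • e) y₀] at h
    simpa [hf] using h
  have habs : R + ‖y₀‖ + 1 ≤ |R + ‖y₀‖ + 1| := le_abs_self _
  linarith

/-- **The island door is the loop door.** `W = HasClassLoop` (a class e₃-poloidal profile one of whose slices carries a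
non-stationary closed vortex line) holds iff some class e₃-poloidal profile carries a planar island bracket of `σ v₂`
(`σ = ±1`) at some time `s₀ < 0` — by `not_frequencyGrowthExponent_iff`, the tree's scalar wall
`frequencyGrowthExponent_iff_noIslands`, and `slice_ne_zero_of_island`. -/
theorem hasClassLoop_iff_hasIsland : HasClassLoop ↔
    ∃ (C : ℝ) (v : ℝ → EuclideanSpace ℝ (Fin 3) → EuclideanSpace ℝ (Fin 3)),
      HasTypeITimeDecay C v ∧ ContinuousOn (uncurry v) (Iio (0 : ℝ) ×ˢ univ) ∧
      (∀ s t : ℝ, s < t → t < 0 → ∀ x, v t x = heatExtension (v s) (t - s) x - oseenDuhamel 1 s v v t x) ∧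
      (∀ t < 0, VectorCalculus.IsDivFree (v t)) ∧
      (∀ s < 0, ∀ y, ⟪curl (v s) y, EuclideanSpace.single 2 1⟫_ℝ = 0) ∧
      ∃ (s₀ z₁ σ M : ℝ) (K O : Set (EuclideanSpace ℝ (Fin 3))), s₀ < 0 ∧
        ((σ = 1 ∨ σ = -1) ∧ IsCompact K ∧ K.Nonempty ∧ (∀ y ∈ K, y 2 = z₁ ∧ σ * v s₀ y 2 = M) ∧
          IsOpen O ∧ K ⊆ O ∧ (∀ y ∈ O, y 2 = z₁ → σ * v s₀ y 2 ≤ M) ∧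
          (∀ y ∈ O, y 2 = z₁ → σ * v s₀ y 2 = M → y ∈ K)) := by
  rw [← not_frequencyGrowthExponent_iff,
    PoloidalWindowDoorPoloidalWindowRigidityLoopIslandReduction.frequencyGrowthExponent_iff_noIslands]
  constructor
  · intro h
    by_contra hne
    exact h fun C v h₁ h₂ h₃ h₄ h₅ s₀ z₁ σ M K O hs₀ hbr =>
      (hne ⟨C, v, h₁, h₂, h₃, h₄, h₅, s₀, z₁, σ, M, K, O, hs₀, hbr⟩).elim
  · rintro ⟨C, v, h₁, h₂, h₃, h₄, h₅, s₀, z₁, σ, M, K, O, hs₀, hbr⟩ hNI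
    obtain ⟨y, hy⟩ := slice_ne_zero_of_island hbr
    exact hy (hNI C v h₁ h₂ h₃ h₄ h₅ s₀ z₁ σ M K O hs₀ hbr s₀ hs₀ y)

/-- **Refutation criterion, scalar form**: the wall fails iff some class e₃-poloidal profile carries a planar island
bracket at some time. -/
theorem not_frequencyGrowthExponent_iff_hasIsland :
    ¬ Summit.NavierStokesRegularity.NavierStokesRegularity.Theses.LoopPeriodRatchet.FrequencyGrowthExponent ↔
    ∃ (C : ℝ) (v : ℝ → EuclideanSpace ℝ (Fin 3) → EuclideanSpace ℝ (Fin 3)),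
      HasTypeITimeDecay C v ∧ ContinuousOn (uncurry v) (Iio (0 : ℝ) ×ˢ univ) ∧
      (∀ s t : ℝ, s < t → t < 0 → ∀ x, v t x = heatExtension (v s) (t - s) x - oseenDuhamel 1 s v v t x) ∧
      (∀ t < 0, VectorCalculus.IsDivFree (v t)) ∧
      (∀ s < 0, ∀ y, ⟪curl (v s) y, EuclideanSpace.single 2 1⟫_ℝ = 0) ∧
      ∃ (s₀ z₁ σ M : ℝ) (K O : Set (EuclideanSpace ℝ (Fin 3))), s₀ < 0 ∧
        ((σ = 1 ∨ σ = -1) ∧ IsCompact K ∧ K.Nonempty ∧ (∀ y ∈ K, y 2 = z₁ ∧ σ * v s₀ y 2 = M) ∧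
          IsOpen O ∧ K ⊆ O ∧ (∀ y ∈ O, y 2 = z₁ → σ * v s₀ y 2 ≤ M) ∧
          (∀ y ∈ O, y 2 = z₁ → σ * v s₀ y 2 = M → y ∈ K)) :=
  not_frequencyGrowthExponent_iff.trans hasClassLoop_iff_hasIsland

end Summit.NavierStokesRegularity.NavierStokesRegularity.Theorems.FrequencyGrowthExponent.Negative

end
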